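import Summits.SmoothPoincare4.SmoothPoincare4.Theorems.RootDecompAEDoublesShadowTwoRoePeel

/-!
# Grade-two dichotomy for KMN encoding graphs (Roe certificates), part 14/17: segments of elimination steps

§11 States `(Φ, E, U)` of the elimination, valid SEGMENTS `Roe.SegValid` and their composition with `Roe.Valid`
(`valid_of_seg`, `seg_append`), killing substitutions `Roe.Kills`, and one-letter steps / segments (`oneLetter_seg`).

THE FAMILY (16 modules `Theorems/RootDecompAEDoublesShadowTwoRoe*.lean` + the closing module
`Theorems/RootDecompAEDoublesShadowTwoStubGradeTwoDichotomy.lean`, one namespace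
`Summit.SmoothPoincare4.SmoothPoincare4.Theorems.RootDecompAEDoublesShadowTwoStubGradeTwoDichotomy`, chained imports,
split by topic to respect the 400-line bound on proof files; the local-table parts import only `…RoeDefs`).
-/

open Function
open Literature.Topology.FourManifolds

set_option linter.dupNamespace false

noncomputable section

namespace Summit.SmoothPoincare4.SmoothPoincare4.Theorems.RootDecompAEDoublesShadowTwoStubGradeTwoDichotomy

/-! ## §11 Segments of elimination steps: states, composition, one-letter steps -/

namespace Roe

variable {n : ℕ}

/-- An elimination STATE: accumulated substitution, eliminated letters, used relators. -/
abbrev State (n : ℕ) : Type := (FreeGroup (Fin n) →* FreeGroup (Fin n)) × Finset (Fin n) × Finset (Fin n)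

/-- The state after one step. -/
def next (s : Step n) (st : State n) : State n :=
  ((substHom s.letter s.word).comp st.1, insert s.letter st.2.1, insert s.rel st.2.2)

/-- ONE ADMISSIBLE STEP from a state (the four conditions of `Valid`). -/
def StepOK (P : BalancedPresentation n) (s : Step n) (st : State n) : Prop :=
  s.letter ∉ st.2.1 ∧ s.rel ∉ st.2.2 ∧
    s.word ∈ Subgroup.closure (FreeGroup.of '' {y : Fin n | y ∉ st.2.1 ∧ y ≠ s.letter}) ∧
      IsConj (st.1 (P s.rel)) (if s.sgn then FreeGroup.of s.letter * s.word else (FreeGroup.of s.letter * s.word)⁻¹)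

/-- A valid SEGMENT of steps from a state: every step admissible from the state reached before it. -/
def SegValid (P : BalancedPresentation n) : List (Step n) → State n → Prop
  | [], _ => True
  | s :: rest, st => StepOK P s st ∧ SegValid P rest (next s st)

/-- The state reached at the end of a segment. -/
def endState : List (Step n) → State n → State n
  | [], st => st
  | s :: rest, st => endState rest (next s st)

/-- `Valid` on a cons, in terms of `StepOK` and `next`. -/
theorem valid_cons_iff {P : BalancedPresentation n} {s : Step n} {rest : List (Step n)} {st : State n} :
    Valid P (s :: rest) st.1 st.2.1 st.2.2 ↔ StepOK P s st ∧ Valid P rest (next s st).1 (next s st).2.1 (next s st).2.2 := by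
  simp only [Valid, StepOK, next, and_assoc]

/-- `SegValid` on a cons. -/
theorem segValid_cons_iff {P : BalancedPresentation n} {s : Step n} {rest : List (Step n)} {st : State n} :
    SegValid P (s :: rest) st ↔ StepOK P s st ∧ SegValid P rest (next s st) := by
  rw [SegValid]

/-- `SegValid` on the empty segment. -/
theorem segValid_nil {P : BalancedPresentation n} {st : State n} : SegValid P [] st := by
  rw [SegValid]; trivial

/-- `endState` on a cons. -/
theorem endState_cons (s : Step n) (rest : List (Step n)) (st : State n) :
    endState (s :: rest) st = endState rest (next s st) := by
  rw [endState]

/-- `endState` on the empty segment. -/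
theorem endState_nil (st : State n) : endState [] st = st := by
  rw [endState]

/-- COMPOSITION: a valid segment followed by a valid step list from its end state is a valid step list. -/
theorem valid_of_seg {P : BalancedPresentation n} (l₁ l₂ : List (Step n)) :
    ∀ st : State n, SegValid P l₁ st → Valid P l₂ (endState l₁ st).1 (endState l₁ st).2.1 (endState l₁ st).2.2 →
      Valid P (l₁ ++ l₂) st.1 st.2.1 st.2.2 := by
  induction l₁ with
  | nil => intro st _ h; rwa [endState_nil] at h
  | cons s rest ih =>
    intro st h₁ h₂
    rw [segValid_cons_iff] at h₁
    rw [endState_cons] at h₂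
    rw [List.cons_append, valid_cons_iff]
    exact ⟨h₁.1, ih _ h₁.2 h₂⟩

/-- COMPOSITION of two valid segments. -/
theorem seg_append {P : BalancedPresentation n} (l₁ l₂ : List (Step n)) :
    ∀ st : State n, SegValid P l₁ st → SegValid P l₂ (endState l₁ st) → SegValid P (l₁ ++ l₂) st := by
  induction l₁ with
  | nil => intro st _ h; rwa [endState_nil] at h
  | cons s rest ih =>
    intro st h₁ h₂
    rw [segValid_cons_iff] at h₁
    rw [endState_cons] at h₂
    rw [List.cons_append, segValid_cons_iff]
    exact ⟨h₁.1, ih _ h₁.2 h₂⟩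

/-- The end state of a concatenation. -/
theorem endState_append (l₁ l₂ : List (Step n)) :
    ∀ st : State n, endState (l₁ ++ l₂) st = endState l₂ (endState l₁ st) := by
  induction l₁ with
  | nil => intro st; rw [List.nil_append, endState_nil]
  | cons s rest ih => intro st; rw [List.cons_append, endState_cons, endState_cons, ih]

/-- A valid segment from the initial state that ends with everything eliminated and used is a certificate. -/
theorem hasCertificate_of_seg {P : BalancedPresentation n} (l : List (Step n))
    (h : SegValid P l (MonoidHom.id _, ∅, ∅)) (hE : (endState l (MonoidHom.id _, ∅, ∅)).2.1 = Finset.univ)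
    (hU : (endState l (MonoidHom.id _, ∅, ∅)).2.2 = Finset.univ) : HasCertificate P := by
  refine ⟨l, ?_⟩
  have := valid_of_seg l [] (MonoidHom.id _, ∅, ∅) h (by rw [Valid]; exact ⟨hE, hU⟩)
  rwa [List.append_nil] at this

/-- The substitution KILLS exactly the letters of `E`: `Φ(y) = 1` for `y ∈ E`, `Φ(y) = y` otherwise. -/
def Kills (Φ : FreeGroup (Fin n) →* FreeGroup (Fin n)) (E : Finset (Fin n)) : Prop :=
  ∀ y, Φ (FreeGroup.of y) = if y ∈ E then 1 else FreeGroup.of y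

/-- The initial state kills nothing. -/
theorem kills_id : Kills (MonoidHom.id (FreeGroup (Fin n))) ∅ := fun y => by simp

/-- The substitution `x ↦ W⁻¹` on a letter. -/
theorem substHom_of (x : Fin n) (W : FreeGroup (Fin n)) (y : Fin n) :
    substHom x W (FreeGroup.of y) = if y = x then W⁻¹ else FreeGroup.of y := by
  simp [substHom]

/-- A ONE-LETTER STEP: a relator that is a single fresh letter `x` eliminates `x` with `W = 1`, and the new substitution
kills `E ∪ {x}`. -/
theorem oneLetter_step {P : BalancedPresentation n} {st : State n} {x r : Fin n} (hK : Kills st.1 st.2.1)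
    (hx : x ∉ st.2.1) (hr : r ∉ st.2.2) (hP : P r = FreeGroup.of x) :
    StepOK P ⟨r, x, 1, true⟩ st ∧ Kills (next ⟨r, x, 1, true⟩ st).1 (next ⟨r, x, 1, true⟩ st).2.1 := by
  refine ⟨⟨hx, hr, one_mem _, ?_⟩, ?_⟩
  · rw [hP, hK x, if_neg hx, if_pos rfl, mul_one]
  · intro y
    simp only [next, MonoidHom.coe_comp, Function.comp_apply, hK y, Finset.mem_insert]
    by_cases hyE : y ∈ st.2.1
    · simp [hyE]
    · by_cases hyx : y = x
      · subst hyx; simp [hyE, substHom_of]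
      · simp [hyE, hyx, substHom_of]

/-- A SEGMENT OF ONE-LETTER STEPS indexed by a duplicate-free list: valid from any killing state in which its letters
are fresh and its relators unused; it ends in the killing state with exactly these letters and relators added. -/
theorem oneLetter_seg {ι : Type} {P : BalancedPresentation n} (lt rl : ι → Fin n) (hlt : Function.Injective lt)
    (hrl : Function.Injective rl) (hP : ∀ i, P (rl i) = FreeGroup.of (lt i)) (l : List ι) :
    ∀ st : State n, l.Nodup → Kills st.1 st.2.1 → (∀ i ∈ l, lt i ∉ st.2.1) → (∀ i ∈ l, rl i ∉ st.2.2) →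
      SegValid P (l.map fun i => (⟨rl i, lt i, 1, true⟩ : Step n)) st ∧
        Kills (endState (l.map fun i => (⟨rl i, lt i, 1, true⟩ : Step n)) st).1
          (endState (l.map fun i => (⟨rl i, lt i, 1, true⟩ : Step n)) st).2.1 ∧
        (endState (l.map fun i => (⟨rl i, lt i, 1, true⟩ : Step n)) st).2.1 = st.2.1 ∪ (l.map lt).toFinset ∧
        (endState (l.map fun i => (⟨rl i, lt i, 1, true⟩ : Step n)) st).2.2 = st.2.2 ∪ (l.map rl).toFinset := by
  classical
  induction l with
  | nil =>
    intro st _ hK _ _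
    rw [List.map_nil, endState_nil]
    refine ⟨segValid_nil, hK, ?_, ?_⟩ <;> simp
  | cons i rest ih =>
    intro st hnd hK hE hU
    obtain ⟨hi, hnd'⟩ := List.nodup_cons.mp hnd
    obtain ⟨hstep, hK'⟩ := oneLetter_step hK (hE i List.mem_cons_self) (hU i List.mem_cons_self) (hP i)
    have hE' : ∀ i' ∈ rest, lt i' ∉ (next (⟨rl i, lt i, 1, true⟩ : Step n) st).2.1 := by
      intro i' hi' h
      simp only [next, Finset.mem_insert] at h
      rcases h with h | h
      · exact hi (hlt h ▸ hi')
      · exact hE i' (List.mem_cons_of_mem _ hi') h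
    have hU' : ∀ i' ∈ rest, rl i' ∉ (next (⟨rl i, lt i, 1, true⟩ : Step n) st).2.2 := by
      intro i' hi' h
      simp only [next, Finset.mem_insert] at h
      rcases h with h | h
      · exact hi (hrl h ▸ hi')
      · exact hU i' (List.mem_cons_of_mem _ hi') h
    obtain ⟨hseg, hK'', hE'', hU''⟩ := ih _ hnd' hK' hE' hU'
    simp only [List.map_cons, endState_cons, segValid_cons_iff]
    refine ⟨⟨hstep, hseg⟩, hK'', ?_, ?_⟩
    · rw [hE'']
      simp only [next, List.toFinset_cons, Finset.insert_union, Finset.union_insert]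
    · rw [hU'']
      simp only [next, List.toFinset_cons, Finset.insert_union, Finset.union_insert]

/-- Conjugate elements have conjugate inverses. -/
theorem isConj_inv {α : Type} [Group α] {a b : α} (h : IsConj a b) : IsConj a⁻¹ b⁻¹ := by
  obtain ⟨c, hc⟩ := isConj_iff.mp h
  exact isConj_iff.mpr ⟨c, by rw [← hc]; group⟩

end Roe

end Summit.SmoothPoincare4.SmoothPoincare4.Theorems.RootDecompAEDoublesShadowTwoStubGradeTwoDichotomy
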